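import Summits.HodgeConjecture.HodgeConjecture.Theorems.MarkmanPartnerTransportHodgeClassesModKappaClass
import Summits.HodgeConjecture.HodgeConjecture.Theorems.MarkmanPartnerTransportKappaClassHodge
import Summits.HodgeConjecture.HodgeConjecture.Theorems.MarkmanPartnerTransportCycleInducedOfKappaClass
import Summits.HodgeConjecture.HodgeConjecture.Theorems.MarkmanPartnerTransportK3Sq2TypeHodgeOfCycleInducedGenerator
import Literature.AlgebraicGeometry.HodgeTheory.BettiHodgeConjectureStandardASmallDimensions
import HarnessLib

/-!
# Orphan levers, «KAPPA-ANY»: on a `K3^{[2]}`-type fourfold with endomorphism field `E(X) = ℚ[θ]` of ANY degree,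
# every rational `(2,2)`-class is algebraic MODULO the kappa classes `κ_{θ^i}`, and HC⁴(X) ⟺ `κ_θ ∈ A²(X)`

Sub-problem `HodgeConjecture`, route MarkmanPartnerTransport, rung «ORPHAN-RM» (memo ROUTE-P1AJ §C, the T3′ cell
«`[E(X):ℚ] ≥ 3`, not multiquadratic»; cell hodge-nonav). The any-degree completion of the gen-13 theorems KAPPA-MOD
(`exists_rat_smul_kappaClass_sub_mem_algebraicClasses`) and KAPPA-IFF
(`OrphanSR.hodgeConjectureFor_iff_kappaClass_mem_algebraicClasses`), which assumed `E(X) = ℚ + ℚθ` real quadratic.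
Here `(X, φ, P, z)` is a marked smooth projective `K3^{[2]}`-type fourfold with a rational, type-preserving,
`q`-self-adjoint endomorphism `θ` of `H²(X(ℂ); ℂ)` such that every rational Hodge endomorphism of `H²` killing `N¹(X)`
with `q`-transcendental image is a rational POLYNOMIAL `Σ_{i<n} aᵢ θⁱ` on `T(X)` (VERBATIM the `hgen` binder of T3′
`OrphanSR.hodgeConjectureFor_of_endomorphismField_of_semiregularSeed`; e.g. `E(X) = ℚ(ζ₇ + ζ₇⁻¹)` cubic):

* `exists_sub_sum_kappaClass_pow_mem_algebraicClasses` (KAPPA-MOD-ANY) — every rational `(2,2)`-class `c` has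
  `c − Σ_{i<n} rᵢ·κ_{θⁱ} ∈ A²(X)` for some `rᵢ ∈ ℚ` (`κ_g = Σᵢⱼ (G⁻¹)ᵢⱼ · φ⁻¹eᵢ ∪ g(φ⁻¹eⱼ)`); mod {Verbitsky–Guan,
  O'Grady 2008}. The gen-13 proof with a finite sum: `π_T F_c π_T = Σ aᵢ θⁱ` on `T(X)`, `F_{κ_{θⁱ}} = tᵢ + 2θⁱ`
  (`exists_cup3_kappaClass`, `θⁱ` self-adjoint), so `c − Σ (aᵢ/2) κ_{θⁱ}` has endomorphism a SCALAR `−Σ aᵢtᵢ/2` on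
  `T(X)` and the tree's `E = ℚ` engine (`k3HilbertForm_blockForm_of_transcendentalScalar`,
  `exists_algebraicClass_of_symmetricForm`, `eq_of_cup3_eq`) makes it algebraic.
* `hodgeConjectureFor_iff_forall_kappaClass_pow_mem_algebraicClasses` (KAPPA-IFF-ANY, Charles–Markman-FREE) —
  `HodgeConjectureFor 4 X ↔ ∀ k, κ_{θᵏ} ∈ A²(X)`; mod {Verbitsky–Guan, O'Grady 2008} (codimensions `≠ 2` of a
  fourfold are in the Lefschetz range: the tree's `hodgeConjectureFor_iff_codim_two_of_dim_eq_four`).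
* `hodgeConjectureFor_iff_kappaClass_mem_algebraicClasses_of_polynomialGeneration` (KAPPA-IFF-ANY′) —
  `HodgeConjectureFor 4 X ↔ κ_θ ∈ A²(X)`; mod {Verbitsky–Guan, O'Grady 2008, Charles–Markman 2013}: (⇐) is T3C
  (`exists_corrAction_eq_of_kappaClass`) + F4 (`hodgeConjectureFor_of_cycleInducedGenerator_of_charlesMarkman`);
  hence `κ_θ ∈ A²(X) ⟹ κ_{θᵏ} ∈ A²(X)` for all `k`.

CONDITIONAL on the named facts displayed; no definition, no sorry; credits nothing to the Hodge conjecture (the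
«ORPHAN-RM» cells stay open). Prover seat hodge-nonav-20241-p1 (gen 14), `--supports stmt-HodgeConjecture-19653`.
References: S. Novario, Kyoto J. Math. 66 (2026) §4–6; K. O'Grady, Commun. Contemp. Math. 10 (2008) §2–3; Yu. Zarhin,
J. reine angew. Math. 341 (1983) Thm. 1.5.1; F. Charles, E. Markman, Compos. Math. 149 (2013) Thm. 1.1; E. Markman,
JEMS (2024) §1.1; C. Voisin, *Hodge Theory I* §7.1, Thm. 6.25, Thm. 11.30.
-/

noncomputable section

set_option linter.dupNamespace false

open scoped Matrix
open Module CategoryTheory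
open Literature.AlgebraicTopology.SingularHomology Literature.Geometry.Kaehler
open Literature.AlgebraicGeometry Literature.AlgebraicGeometry.Motives Literature.AlgebraicGeometry.HodgeTheory
open Literature.AlgebraicGeometry.Hyperkaehler Literature.AlgebraicGeometry.Surfaces
open Summit.HodgeConjecture.HodgeConjecture.Theorems.NikulinTwinTransport
open Summit.HodgeConjecture.HodgeConjecture.Theorems.MarkmanPartnerTransport.BBFPositivity

namespace Summit.HodgeConjecture.HodgeConjecture.Theorems.MarkmanPartnerTransport.PartnerLattice

/-- `MarkedK3Sq[X, φ, P, z]`: VERBATIM the `let MarkedK3Sq := …` binder of the route declarations of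
MarkmanPartnerTransport (clauses (m1)–(m6)). Local notation only. -/
local notation3 (prettyPrint := false) "MarkedK3Sq[" X ", " φ ", " P ", " z "]" =>
  (((IsIntegralClass P ∧ ∀ Q : complexBetti X (2 * 4), IsIntegralClass Q → ∃ n : ℤ, Q = n • P) ∧
    (∀ c : complexBetti X 2, IsIntegralClass c ↔ ∃ v : K3HilbertIndex → ℤ, φ c = fun i => (v i : ℂ)) ∧
    (∀ a : complexBetti X 2, cupPowTwo a 4 = ((3 : ℂ) * (k3HilbertForm 2 (φ a) (φ a)) ^ 2) • P) ∧
    (IsOfHodgeType 4 X 2 2 0 (LinearEquiv.symm φ z) ∧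
      ∀ τ : complexBetti X 2, IsOfHodgeType 4 X 2 2 0 τ → ∃ t : ℂ, τ = t • LinearEquiv.symm φ z) ∧
    (∀ c : complexBetti X 2, IsOfHodgeType 4 X 2 1 1 c ↔
      (k3HilbertForm 2 (φ c) z = 0 ∧ k3HilbertForm 2 (φ c) (star z) = 0)) ∧
    (k3HilbertForm 2 z z = 0 ∧ 0 < (k3HilbertForm 2 (star z) z).re)))

/-- `Cup3[c, y, w] = (c ∪ y) ∪ w ∈ H⁸` for `c ∈ H⁴`, `y, w ∈ H²`. Local notation only. -/
local notation3 (prettyPrint := false) "Cup3[" c ", " y ", " w "]" =>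
  cupProduct (rfl : 2 * 3 + 2 = 2 * 4) (cupProduct (rfl : 2 * 2 + 2 = 2 * 3) c y) w

/-- `Kap[φ, g] = Σ_{ij} (G⁻¹)_{ij} · φ⁻¹eᵢ ∪ g(φ⁻¹eⱼ) ∈ H⁴(X(ℂ); ℂ)`, the kappa class of an endomorphism `g`
of `H²(X(ℂ); ℂ)` (VERBATIM `…K3Sq2TypeHodgeGraphClassesGeneral`). Local notation only. -/
local notation3 (prettyPrint := false) "Kap[" φ ", " g "]" =>
  (∑ i : K3HilbertIndex, ∑ j : K3HilbertIndex,
    (((k3HilbertGram 2).map (Int.cast : ℤ → ℂ))⁻¹ i j) •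
      cupProduct (rfl : 2 + 2 = 2 * 2) ((LinearEquiv.symm φ) (Pi.single i 1))
        (g ((LinearEquiv.symm φ) (Pi.single j 1))))

variable {X : SchemeOver ℂ} {φ : complexBetti X 2 ≃ₗ[ℂ] (K3HilbertIndex → ℂ)} {P : complexBetti X (2 * 4)}
  {z : K3HilbertIndex → ℂ}

/-! ### Powers of a rational, type-preserving, self-adjoint endomorphism -/

/-- Powers of a rationality-preserving endomorphism preserve rational classes. [folklore] -/
theorem isRationalClass_pow_apply (θ : complexBetti X 2 →ₗ[ℂ] complexBetti X 2)
    (h1 : ∀ y, IsRationalClass y → IsRationalClass (θ y)) :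
    ∀ (k : ℕ) (y : complexBetti X 2), IsRationalClass y → IsRationalClass ((θ ^ k) y) := by
  intro k
  induction k with
  | zero => intro y hy; simpa only [pow_zero, Module.End.one_apply] using hy
  | succ k ih => intro y hy; rw [pow_succ', Module.End.mul_apply]; exact h1 _ (ih y hy)

/-- Powers of a type-preserving endomorphism preserve Hodge types. [folklore] -/
theorem isOfHodgeType_pow_apply (θ : complexBetti X 2 →ₗ[ℂ] complexBetti X 2)
    (h2 : ∀ (i j : ℕ) y, IsOfHodgeType 4 X 2 i j y → IsOfHodgeType 4 X 2 i j (θ y)) :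
    ∀ (k : ℕ) (i j : ℕ) (y : complexBetti X 2), IsOfHodgeType 4 X 2 i j y → IsOfHodgeType 4 X 2 i j ((θ ^ k) y) := by
  intro k
  induction k with
  | zero => intro i j y hy; simpa only [pow_zero, Module.End.one_apply] using hy
  | succ k ih => intro i j y hy; rw [pow_succ', Module.End.mul_apply]; exact h2 i j _ (ih i j y hy)

/-- Powers of a `q`-self-adjoint endomorphism are `q`-self-adjoint (in a marking `φ`). [folklore] -/
theorem k3HilbertForm_pow_selfAdjoint (φ : complexBetti X 2 ≃ₗ[ℂ] (K3HilbertIndex → ℂ))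
    (θ : complexBetti X 2 →ₗ[ℂ] complexBetti X 2)
    (h5 : ∀ y w : complexBetti X 2, k3HilbertForm 2 (φ (θ y)) (φ w) = k3HilbertForm 2 (φ y) (φ (θ w))) :
    ∀ (k : ℕ) (y w : complexBetti X 2),
      k3HilbertForm 2 (φ ((θ ^ k) y)) (φ w) = k3HilbertForm 2 (φ y) (φ ((θ ^ k) w)) := by
  intro k
  induction k with
  | zero => intro y w; simp only [pow_zero, Module.End.one_apply]
  | succ k ih =>
    intro y w
    rw [pow_succ', Module.End.mul_apply, h5, ih, ← Module.End.mul_apply, ← pow_succ', ← pow_succ, pow_succ']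

/-- `q(φ (Σᵢ uᵢ • vᵢ), φ w) = Σᵢ uᵢ · q(φ vᵢ, φ w)` (linearity of the Beauville–Bogomolov form in a marking).
[folklore] -/
theorem k3HilbertForm_sum_smul_left (φ : complexBetti X 2 ≃ₗ[ℂ] (K3HilbertIndex → ℂ)) {ι : Type*}
    (s : Finset ι) (u : ι → ℂ) (v : ι → complexBetti X 2) (w : complexBetti X 2) :
    k3HilbertForm 2 (φ (∑ i ∈ s, u i • v i)) (φ w) = ∑ i ∈ s, u i * k3HilbertForm 2 (φ (v i)) (φ w) := by
  classical
  induction s using Finset.induction_on with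
  | empty =>
    rw [Finset.sum_empty, Finset.sum_empty, map_zero]
    have h := k3HilbertForm_smul_left 2 (0 : ℂ) (0 : K3HilbertIndex → ℂ) (φ w)
    rwa [zero_smul, zero_mul] at h
  | insert i s hi ih =>
    rw [Finset.sum_insert hi, Finset.sum_insert hi, map_add, map_smul, k3HilbertForm_add_left,
      k3HilbertForm_smul_left, ih]

/-! ### KAPPA-MOD-ANY -/

/-- **(KAPPA-MOD-ANY) Every rational `(2,2)`-class is algebraic modulo `Σ_{i<n} ℚ·κ_{θⁱ}`** on a marked smooth
projective `K3^{[2]}`-type fourfold whose rational Hodge endomorphisms of `H²` killing `N¹(X)` with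
`q`-transcendental image are rational POLYNOMIALS `Σ_{i<n} aᵢθⁱ` on `T(X)` in ONE rational, type-preserving,
`q`-self-adjoint `θ` (`E(X) = ℚ[θ]` of any degree; any Picard rank, partnered or orphan): for every rational class
`c` of type `(2,2)` there are `n` and `r : Fin n → ℚ` with `c − Σᵢ rᵢ·κ_{θⁱ} ∈ A²(X)`. With `F = F_c`,
`π_T F π_T = Σ aᵢθⁱ` on `T` and `F_{κ_{θⁱ}} = tᵢ + 2θⁱ`, the class `c − Σ (aᵢ/2)κ_{θⁱ}` has endomorphism the scalar
`−Σ aᵢtᵢ/2` on `T`, so it is algebraic by the `E = ℚ` engine (`exists_algebraicClass_of_symmetricForm` +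
`eq_of_cup3_eq`). Modulo {Verbitsky–Guan, O'Grady 2008}. [cite: Novario2026HodgeClassesHilbertSquares, Thm. 6.2 and §4]
[cite: OGrady2008NumericalK3Square, §3] [cite: Zarhin1983HodgeGroupsK3, Thm. 1.5.1] -/
theorem exists_sub_sum_kappaClass_pow_mem_algebraicClasses
    (hV : VerbitskyGuan_cohomology_K3HilbertSquareType) (hO : OGrady2008_dualBBFClass_algebraic)
    (hX : IsSmoothProjective 4 X) (hK : IsOfK3HilbertSquareType X) (hM : MarkedK3Sq[X, φ, P, z])
    (θ : complexBetti X 2 →ₗ[ℂ] complexBetti X 2)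
    (h1 : ∀ y, IsRationalClass y → IsRationalClass (θ y))
    (h2 : ∀ (i j : ℕ) y, IsOfHodgeType 4 X 2 i j y → IsOfHodgeType 4 X 2 i j (θ y))
    (h5 : ∀ y w : complexBetti X 2, k3HilbertForm 2 (φ (θ y)) (φ w) = k3HilbertForm 2 (φ y) (φ (θ w)))
    (hgen : ∀ f : complexBetti X 2 →ₗ[ℂ] complexBetti X 2, (∀ y, IsRationalClass y → IsRationalClass (f y)) →
      (∀ (i j : ℕ) y, IsOfHodgeType 4 X 2 i j y → IsOfHodgeType 4 X 2 i j (f y)) →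
      (∀ d : complexBetti X 2, d ∈ algebraicClasses X 1 → f d = 0) →
      (∀ y : complexBetti X 2, ∀ d : complexBetti X 2, d ∈ algebraicClasses X 1 →
        k3HilbertForm 2 (φ (f y)) (φ d) = 0) →
      ∃ (n : ℕ) (a : Fin n → ℚ), ∀ y : complexBetti X 2,
        (∀ d : complexBetti X 2, d ∈ algebraicClasses X 1 → k3HilbertForm 2 (φ y) (φ d) = 0) →
        f y = ∑ i : Fin n, ((a i : ℂ) • (θ ^ (i : ℕ)) y))
    {c : complexBetti X (2 * 2)} (hcrat : IsRationalClass c) (hc22 : IsOfHodgeType 4 X (2 * 2) 2 2 c) :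
    ∃ (n : ℕ) (r : Fin n → ℚ), c - ∑ i : Fin n, (r i : ℂ) • Kap[φ, θ ^ (i : ℕ)] ∈ algebraicClasses X 2 := by
  classical
  obtain ⟨F, hF⟩ := exists_classEndomorphism hX hM c
  have hFrat : ∀ y, IsRationalClass y → IsRationalClass (F y) :=
    fun y hy => isRationalClass_classEndomorphism hX hM hF hcrat hy
  have hFh : ∀ (i j : ℕ) y, IsOfHodgeType 4 X 2 i j y → IsOfHodgeType 4 X 2 i j (F y) :=
    fun i j y hy => isOfHodgeType_classEndomorphism hX hM hF hc22 hy
  have hFadj : ∀ y w, k3HilbertForm 2 (φ (F y)) (φ w) = k3HilbertForm 2 (φ y) (φ (F w)) :=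
    classEndomorphism_selfAdjoint hX hM hF
  obtain ⟨πT, hT1, hT2, hT3, hT4, hT5, hT6, hT7⟩ := exists_transcendentalProjector hX hM
  have hN11 : ∀ d ∈ algebraicClasses X 1, IsOfHodgeType 4 X 2 1 1 d := fun d hd =>
    isOfHodgeType_of_mem_algebraicClasses_of_isSmoothProjective hX 1 hd
  have hPrat := isRationalClass_pow_apply θ h1
  have hPtyp := isOfHodgeType_pow_apply θ h2
  have hPadj := k3HilbertForm_pow_selfAdjoint φ θ h5
  have hθN : ∀ (k : ℕ), ∀ d ∈ algebraicClasses X 1, (θ ^ k) d ∈ algebraicClasses X 1 := fun k =>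
    map_mem_algebraicClasses_one_of_rational_hodge hX (θ ^ k) (hPrat k) (hPtyp k 1 1)
  have hθT : ∀ (k : ℕ) (y : complexBetti X 2), (∀ d ∈ algebraicClasses X 1, k3HilbertForm 2 (φ y) (φ d) = 0) →
      ∀ d ∈ algebraicClasses X 1, k3HilbertForm 2 (φ ((θ ^ k) y)) (φ d) = 0 :=
    fun k y hy d hd => by rw [hPadj]; exact hy _ (hθN k d hd)
  -- Claim A: `πT (F d) = 0` for `d ∈ N¹(X)`
  have hA : ∀ d ∈ algebraicClasses X 1, πT (F d) = 0 := by
    have hspan := supportedClasses_eq_span_isRationalClass hX 2 1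
    change algebraicClasses X 1 = Submodule.span ℂ
      {c : complexBetti X 2 | IsRationalClass c ∧ c ∈ algebraicClasses X 1} at hspan
    intro d hd
    rw [hspan] at hd
    have hle : Submodule.span ℂ {c : complexBetti X 2 | IsRationalClass c ∧ c ∈ algebraicClasses X 1} ≤
        LinearMap.ker (πT ∘ₗ F) := by
      refine Submodule.span_le.2 ?_
      rintro d ⟨hdrat, hdalg⟩
      rw [SetLike.mem_coe, LinearMap.mem_ker, LinearMap.comp_apply]
      have hu_alg : πT (F d) ∈ algebraicClasses X 1 :=
        lefschetzOneOne_rational_holds hX _ (hT5 _ (hFrat _ hdrat)) (hT7 1 1 _ (hFh 1 1 _ (hN11 d hdalg)))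
      exact k3HilbertForm_radical_algebraicClasses_one_eq_zero hX hM hu_alg (hT3 (F d))
    simpa only [LinearMap.mem_ker, LinearMap.comp_apply] using hle hd
  obtain ⟨n, a, hacc⟩ := hgen (πT ∘ₗ F ∘ₗ πT)
    (fun y hy => by rw [LinearMap.comp_apply, LinearMap.comp_apply]; exact hT5 _ (hFrat _ (hT5 _ hy)))
    (fun i j y hy => by
      rw [LinearMap.comp_apply, LinearMap.comp_apply]; exact hT7 i j _ (hFh i j _ (hT7 i j _ hy)))
    (fun d hd => by rw [LinearMap.comp_apply, LinearMap.comp_apply, hT1 d hd, map_zero, map_zero])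
    (fun y d hd => by rw [LinearMap.comp_apply, LinearMap.comp_apply]; exact hT3 _ d hd)
  -- the cubics of the `κ_{θⁱ}`: `F_{κ_{θⁱ}} = tᵢ + 2θⁱ`
  have ht : ∀ i : Fin n, ∃ t : ℂ, ∀ y w : complexBetti X 2,
      Cup3[Kap[φ, θ ^ (i : ℕ)], y, w] = (t * k3HilbertForm 2 (φ y) (φ w) +
        k3HilbertForm 2 (φ ((θ ^ (i : ℕ)) y)) (φ w) + k3HilbertForm 2 (φ ((θ ^ (i : ℕ)) w)) (φ y)) • P :=
    fun i => exists_cup3_kappaClass hM (θ ^ (i : ℕ))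
  choose t ht using ht
  -- `G := F − (Σ aᵢtᵢ/2) − Σ aᵢθⁱ`, the endomorphism of `c₁ := c − Σ (aᵢ/2) κ_{θⁱ}`
  set s : ℂ := ∑ i : Fin n, (a i : ℂ) * t i / 2 with hsdef
  set G : complexBetti X 2 →ₗ[ℂ] complexBetti X 2 :=
    F - s • LinearMap.id - ∑ i : Fin n, (a i : ℂ) • (θ ^ (i : ℕ)) with hGdef
  have hGapp : ∀ y, G y = F y - s • y - ∑ i : Fin n, (a i : ℂ) • (θ ^ (i : ℕ)) y := fun y => by
    simp only [hGdef, LinearMap.sub_apply, LinearMap.smul_apply, LinearMap.id_apply, LinearMap.coe_sum,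
      Finset.sum_apply]
  have hqG : ∀ y w, k3HilbertForm 2 (φ (G y)) (φ w) = k3HilbertForm 2 (φ (F y)) (φ w) -
      s * k3HilbertForm 2 (φ y) (φ w) - ∑ i : Fin n, (a i : ℂ) * k3HilbertForm 2 (φ ((θ ^ (i : ℕ)) y)) (φ w) := by
    intro y w
    rw [hGapp, map_sub, map_sub, map_smul, sub_eq_add_neg, sub_eq_add_neg, k3HilbertForm_add_left,
      k3HilbertForm_add_left, ← neg_one_smul ℂ (s • φ y), smul_smul, k3HilbertForm_smul_left,
      ← map_neg, ← Finset.sum_neg_distrib]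
    simp_rw [← neg_smul]
    rw [k3HilbertForm_sum_smul_left]
    simp_rw [neg_mul]
    rw [Finset.sum_neg_distrib]
    ring
  -- `q(θⁱ w, y) = q(θⁱ y, w)`, so `F_{κ_{θⁱ}} = tᵢ + 2θⁱ`
  have hsym : ∀ (k : ℕ) (y w : complexBetti X 2),
      k3HilbertForm 2 (φ ((θ ^ k) w)) (φ y) = k3HilbertForm 2 (φ ((θ ^ k) y)) (φ w) := fun k y w => by
    rw [hPadj, k3HilbertForm_comm]
  have ht' : ∀ (i : Fin n) (y w : complexBetti X 2), Cup3[Kap[φ, θ ^ (i : ℕ)], y, w] =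
      (t i * k3HilbertForm 2 (φ y) (φ w) + 2 * k3HilbertForm 2 (φ ((θ ^ (i : ℕ)) y)) (φ w)) • P := by
    intro i y w
    rw [ht, hsym (i : ℕ) y w]
    congr 1
    ring
  have hL3 : ∀ (u : Fin n → ℂ) (A : Fin n → complexBetti X (2 * 2)) (y w : complexBetti X 2),
      Cup3[∑ i : Fin n, u i • A i, y, w] = ∑ i : Fin n, u i • Cup3[A i, y, w] := fun u A y w => by
    simp only [map_sum, map_smul, LinearMap.coe_sum, Finset.sum_apply, LinearMap.smul_apply]
  have hc₁ : ∀ y w, Cup3[c - ∑ i : Fin n, (((a i / 2 : ℚ) : ℂ)) • Kap[φ, θ ^ (i : ℕ)], y, w] =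
      (k3HilbertForm 2 (φ (G y)) (φ w)) • P := by
    intro y w
    rw [map_sub, LinearMap.sub_apply, map_sub, LinearMap.sub_apply, hL3, hF]
    simp_rw [ht', smul_smul]
    rw [← Finset.sum_smul, ← sub_smul, hqG, sub_sub]
    congr 2
    rw [hsdef, Finset.sum_mul, ← Finset.sum_add_distrib]
    refine Finset.sum_congr rfl fun i _ => ?_
    push_cast
    ring
  have hGadj : ∀ y w, k3HilbertForm 2 (φ (G y)) (φ w) = k3HilbertForm 2 (φ y) (φ (G w)) := by
    intro y w
    rw [k3HilbertForm_comm 2 (φ y) (φ (G w)), hqG, hqG, hFadj w y, k3HilbertForm_comm 2 (φ w) (φ (F y)),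
      k3HilbertForm_comm 2 (φ w) (φ y)]
    simp_rw [hsym _ y w]
  have hGA : ∀ d ∈ algebraicClasses X 1, πT (G d) = 0 := fun d hd => by
    rw [hGapp, map_sub, map_sub, map_smul, map_sum, hA d hd, hT1 d hd, smul_zero, sub_zero, zero_sub,
      neg_eq_zero]
    exact Finset.sum_eq_zero fun i _ => by rw [map_smul, hT1 _ (hθN _ d hd), smul_zero]
  have hGC : ∀ y : complexBetti X 2, (∀ d ∈ algebraicClasses X 1, k3HilbertForm 2 (φ y) (φ d) = 0) →
      πT (G y) = (-s) • y := by
    intro y hy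
    have e1 : πT (F (πT y)) = ∑ i : Fin n, (a i : ℂ) • (θ ^ (i : ℕ)) y := by
      have := hacc y hy
      rwa [LinearMap.comp_apply, LinearMap.comp_apply] at this
    rw [hT2 y hy] at e1
    rw [hGapp, map_sub, map_sub, map_smul, map_sum, e1, hT2 y hy]
    have e2 : ∑ i : Fin n, πT ((a i : ℂ) • (θ ^ (i : ℕ)) y) = ∑ i : Fin n, (a i : ℂ) • (θ ^ (i : ℕ)) y :=
      Finset.sum_congr rfl fun i _ => by rw [map_smul, hT2 _ (hθT _ y hy)]
    rw [e2, neg_smul]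
    abel
  set a' : ℂ := -s with ha'def
  have hβG := k3HilbertForm_blockForm_of_transcendentalScalar φ hGadj hT2 hT3 hT4 hT6 hGA hGC
  set qXform : LinearMap.BilinForm ℂ (complexBetti X 2) :=
    (Matrix.toBilin' (Matrix.map (k3HilbertGram 2) (Int.cast : ℤ → ℂ))).compl₁₂
      (φ : complexBetti X 2 →ₗ[ℂ] (K3HilbertIndex → ℂ)) (φ : complexBetti X 2 →ₗ[ℂ] (K3HilbertIndex → ℂ))
    with hqXform
  have hqXapp : ∀ y w, qXform y w = k3HilbertForm 2 (φ y) (φ w) := fun y w => by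
    rw [hqXform, LinearMap.compl₁₂_apply, qC_apply]; rfl
  set β : complexBetti X 2 →ₗ[ℂ] complexBetti X 2 →ₗ[ℂ] ℂ :=
    qXform.compl₁₂ G LinearMap.id - a' • qXform with hβraw
  have hβdef : ∀ y w, β y w = k3HilbertForm 2 (φ (G y)) (φ w) - a' * k3HilbertForm 2 (φ y) (φ w) := by
    intro y w
    rw [hβraw, LinearMap.sub_apply, LinearMap.smul_apply, LinearMap.sub_apply, LinearMap.smul_apply,
      LinearMap.compl₁₂_apply, LinearMap.id_apply, hqXapp, hqXapp, smul_eq_mul]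
  clear_value β
  have hβsymm : ∀ y w, β y w = β w y := fun y w => by
    rw [hβdef, hβdef, hGadj, k3HilbertForm_comm 2 (φ y) (φ (G w)), k3HilbertForm_comm 2 (φ y) (φ w)]
  have hNT : ∀ n ∈ algebraicClasses X 1, ∀ w, k3HilbertForm 2 (φ n) (φ (πT w)) = 0 := fun n hn w => by
    rw [k3HilbertForm_comm]; exact hT3 w n hn
  have hqr : ∀ n ∈ algebraicClasses X 1, ∀ y : complexBetti X 2,
      k3HilbertForm 2 (φ n) (φ (y - πT y)) = k3HilbertForm 2 (φ n) (φ y) := by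
    intro n hn y
    rw [map_sub, sub_eq_add_neg, k3HilbertForm_add_right, ← neg_one_smul ℂ, k3HilbertForm_smul_right,
      hNT n hn y, mul_zero, add_zero]
  obtain ⟨c', hc'alg, hc'⟩ := exists_algebraicClass_of_symmetricForm hO Voisin2003_cupProduct_algebraicClasses_holds'
    hX hK hM a' β hβsymm (fun y => y - πT y) hT4 hqr
  have hcup3 : ∀ y w : complexBetti X 2,
      Cup3[c - ∑ i : Fin n, (((a i / 2 : ℚ) : ℂ)) • Kap[φ, θ ^ (i : ℕ)], y, w] = Cup3[c', y, w] :=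
    fun y w => by rw [hc₁, hc', hβG, hβdef]
  exact ⟨n, fun i => a i / 2, eq_of_cup3_eq hV hX hK hcup3 ▸ hc'alg⟩

/-! ### KAPPA-IFF-ANY -/

/-- **(KAPPA-IFF-ANY, Charles–Markman-free) `HC(X) ⟺ κ_{θᵏ} ∈ A²(X)` for all `k`**, on a marked smooth projective
`K3^{[2]}`-type fourfold with polynomial `End_Hdg`-generation `Σ_{i<n} aᵢθⁱ` on `T(X)` in ONE rational, type-preserving,
`q`-self-adjoint `θ` (`E(X) = ℚ[θ]` of any degree). (⇒): each `κ_{θᵏ}` is a RATIONAL class of HODGE TYPE `(2,2)`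
(`isRationalClass_kappaClass`, `isOfHodgeType_kappaClass`); (⇐): KAPPA-MOD-ANY
(`exists_sub_sum_kappaClass_pow_mem_algebraicClasses`) in codimension `2`, the Lefschetz range elsewhere
(`hodgeConjectureFor_iff_codim_two_of_dim_eq_four`). Modulo
{Verbitsky–Guan, O'Grady 2008} (used by (⇐) only). [cite: Novario2026HodgeClassesHilbertSquares, Thm. 6.2 and §4]
[cite: OGrady2008NumericalK3Square, §2.2 and §3] [cite: Markman2024, §1.1 Thm. 1.1] -/
theorem hodgeConjectureFor_iff_forall_kappaClass_pow_mem_algebraicClasses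
    (hV : VerbitskyGuan_cohomology_K3HilbertSquareType) (hO : OGrady2008_dualBBFClass_algebraic)
    (hX : IsSmoothProjective 4 X) (hK : IsOfK3HilbertSquareType X) (hM : MarkedK3Sq[X, φ, P, z])
    (θ : complexBetti X 2 →ₗ[ℂ] complexBetti X 2)
    (h1 : ∀ y, IsRationalClass y → IsRationalClass (θ y))
    (h2 : ∀ (i j : ℕ) y, IsOfHodgeType 4 X 2 i j y → IsOfHodgeType 4 X 2 i j (θ y))
    (h5 : ∀ y w : complexBetti X 2, k3HilbertForm 2 (φ (θ y)) (φ w) = k3HilbertForm 2 (φ y) (φ (θ w)))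
    (hgen : ∀ f : complexBetti X 2 →ₗ[ℂ] complexBetti X 2, (∀ y, IsRationalClass y → IsRationalClass (f y)) →
      (∀ (i j : ℕ) y, IsOfHodgeType 4 X 2 i j y → IsOfHodgeType 4 X 2 i j (f y)) →
      (∀ d : complexBetti X 2, d ∈ algebraicClasses X 1 → f d = 0) →
      (∀ y : complexBetti X 2, ∀ d : complexBetti X 2, d ∈ algebraicClasses X 1 →
        k3HilbertForm 2 (φ (f y)) (φ d) = 0) →
      ∃ (n : ℕ) (a : Fin n → ℚ), ∀ y : complexBetti X 2,
        (∀ d : complexBetti X 2, d ∈ algebraicClasses X 1 → k3HilbertForm 2 (φ y) (φ d) = 0) →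
        f y = ∑ i : Fin n, ((a i : ℂ) • (θ ^ (i : ℕ)) y)) :
    HodgeConjectureFor 4 X ↔ ∀ k : ℕ, Kap[φ, θ ^ k] ∈ algebraicClasses X 2 := by
  refine ⟨fun h k => h.2 2 _ (isRationalClass_kappaClass hX hM (θ ^ k) (isRationalClass_pow_apply θ h1 k))
    (isOfHodgeType_kappaClass hX hM (θ ^ k) (isOfHodgeType_pow_apply θ h2 k)), fun hκ => ?_⟩
  refine (hodgeConjectureFor_iff_codim_two_of_dim_eq_four hX).2 fun c hcrat hc22 => ?_
  obtain ⟨n, r, hr⟩ :=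
    exists_sub_sum_kappaClass_pow_mem_algebraicClasses hV hO hX hK hM θ h1 h2 h5 hgen hcrat hc22
  have hsum : ∑ i : Fin n, (r i : ℂ) • Kap[φ, θ ^ (i : ℕ)] ∈ algebraicClasses X 2 :=
    Submodule.sum_mem _ fun i _ => Submodule.smul_mem _ _ (hκ i)
  simpa only [sub_add_cancel] using Submodule.add_mem _ hr hsum

/-- **(KAPPA-IFF-ANY′) `HC(X) ⟺ κ_θ ∈ A²(X)`** for `E(X) = ℚ[θ]` of ANY degree (polynomial `End_Hdg`-generation on
`T(X)` in one rational, type-preserving, `q`-self-adjoint `θ`), on a marked smooth projective `K3^{[2]}`-type fourfold.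
(⇒): `κ_θ` is a rational `(2,2)`-class; (⇐): `κ_θ ∈ A²(X)` makes `θ` CYCLE-INDUCED (T3C
`exists_corrAction_eq_of_kappaClass`), and a cycle-induced polynomial generator gives HC(X) (F4
`hodgeConjectureFor_of_cycleInducedGenerator_of_charlesMarkman`). Modulo {Verbitsky–Guan, O'Grady 2008,
Charles–Markman 2013} (used by (⇐) only). [cite: CharlesMarkman2013, Thm. 1.1 (§1)] [cite: Markman2024, §1.1 Thm. 1.1]
[cite: OGrady2008NumericalK3Square, §2.2 and §3] -/
theorem hodgeConjectureFor_iff_kappaClass_mem_algebraicClasses_of_polynomialGeneration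
    (hV : VerbitskyGuan_cohomology_K3HilbertSquareType) (hO : OGrady2008_dualBBFClass_algebraic)
    (hB : CharlesMarkman2013_lefschetzStandard_K3HilbertType)
    (hX : IsSmoothProjective 4 X) (hK : IsOfK3HilbertSquareType X) (hM : MarkedK3Sq[X, φ, P, z])
    (θ : complexBetti X 2 →ₗ[ℂ] complexBetti X 2)
    (h1 : ∀ y, IsRationalClass y → IsRationalClass (θ y))
    (h2 : ∀ (i j : ℕ) y, IsOfHodgeType 4 X 2 i j y → IsOfHodgeType 4 X 2 i j (θ y))
    (h5 : ∀ y w : complexBetti X 2, k3HilbertForm 2 (φ (θ y)) (φ w) = k3HilbertForm 2 (φ y) (φ (θ w)))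
    (hgen : ∀ f : complexBetti X 2 →ₗ[ℂ] complexBetti X 2, (∀ y, IsRationalClass y → IsRationalClass (f y)) →
      (∀ (i j : ℕ) y, IsOfHodgeType 4 X 2 i j y → IsOfHodgeType 4 X 2 i j (f y)) →
      (∀ d : complexBetti X 2, d ∈ algebraicClasses X 1 → f d = 0) →
      (∀ y : complexBetti X 2, ∀ d : complexBetti X 2, d ∈ algebraicClasses X 1 →
        k3HilbertForm 2 (φ (f y)) (φ d) = 0) →
      ∃ (n : ℕ) (a : Fin n → ℚ), ∀ y : complexBetti X 2,
        (∀ d : complexBetti X 2, d ∈ algebraicClasses X 1 → k3HilbertForm 2 (φ y) (φ d) = 0) →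
        f y = ∑ i : Fin n, ((a i : ℂ) • (θ ^ (i : ℕ)) y)) :
    HodgeConjectureFor 4 X ↔ Kap[φ, θ] ∈ algebraicClasses X 2 :=
  ⟨fun h => h.2 2 _ (isRationalClass_kappaClass hX hM θ h1) (isOfHodgeType_kappaClass hX hM θ h2),
    fun hκ => hodgeConjectureFor_of_cycleInducedGenerator_of_charlesMarkman hV hO hB hX hK hM θ h1 h2
      (exists_corrAction_eq_of_kappaClass hV hB hX hK hM θ h5 hκ) hgen⟩

/-- **`κ_θ ∈ A²(X) ⟹ κ_{θᵏ} ∈ A²(X)` for every `k`** in the setting of KAPPA-IFF-ANY′: the algebraicity of the one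
class `κ_θ` propagates to the kappa classes of all powers (through HC(X)). Modulo {Verbitsky–Guan, O'Grady 2008,
Charles–Markman 2013}. [cite: CharlesMarkman2013, Thm. 1.1 (§1)] [cite: Markman2024, §1.1 Thm. 1.1] -/
theorem kappaClass_pow_mem_algebraicClasses_of_kappaClass_mem
    (hV : VerbitskyGuan_cohomology_K3HilbertSquareType) (hO : OGrady2008_dualBBFClass_algebraic)
    (hB : CharlesMarkman2013_lefschetzStandard_K3HilbertType)
    (hX : IsSmoothProjective 4 X) (hK : IsOfK3HilbertSquareType X) (hM : MarkedK3Sq[X, φ, P, z])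
    (θ : complexBetti X 2 →ₗ[ℂ] complexBetti X 2)
    (h1 : ∀ y, IsRationalClass y → IsRationalClass (θ y))
    (h2 : ∀ (i j : ℕ) y, IsOfHodgeType 4 X 2 i j y → IsOfHodgeType 4 X 2 i j (θ y))
    (h5 : ∀ y w : complexBetti X 2, k3HilbertForm 2 (φ (θ y)) (φ w) = k3HilbertForm 2 (φ y) (φ (θ w)))
    (hgen : ∀ f : complexBetti X 2 →ₗ[ℂ] complexBetti X 2, (∀ y, IsRationalClass y → IsRationalClass (f y)) →
      (∀ (i j : ℕ) y, IsOfHodgeType 4 X 2 i j y → IsOfHodgeType 4 X 2 i j (f y)) →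
      (∀ d : complexBetti X 2, d ∈ algebraicClasses X 1 → f d = 0) →
      (∀ y : complexBetti X 2, ∀ d : complexBetti X 2, d ∈ algebraicClasses X 1 →
        k3HilbertForm 2 (φ (f y)) (φ d) = 0) →
      ∃ (n : ℕ) (a : Fin n → ℚ), ∀ y : complexBetti X 2,
        (∀ d : complexBetti X 2, d ∈ algebraicClasses X 1 → k3HilbertForm 2 (φ y) (φ d) = 0) →
        f y = ∑ i : Fin n, ((a i : ℂ) • (θ ^ (i : ℕ)) y))
    (hκ : Kap[φ, θ] ∈ algebraicClasses X 2) (k : ℕ) :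
    Kap[φ, θ ^ k] ∈ algebraicClasses X 2 :=
  (hodgeConjectureFor_iff_forall_kappaClass_pow_mem_algebraicClasses hV hO hX hK hM θ h1 h2 h5 hgen).1
    ((hodgeConjectureFor_iff_kappaClass_mem_algebraicClasses_of_polynomialGeneration hV hO hB hX hK hM θ h1 h2 h5
      hgen).2 hκ) k

end Summit.HodgeConjecture.HodgeConjecture.Theorems.MarkmanPartnerTransport.PartnerLattice

end
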